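import Literature.NumberTheory.GaloisRepresentations.IdeleClassBarBoundaryIdeleInvariant
import Literature.NumberTheory.GaloisRepresentations.HomDualLocalPairingGlobal
import Literature.NumberTheory.GaloisRepresentations.PresentationGaloisModules
import HarnessLib

/-!
# The TRANSPORT of the presentation road, by explicit cocycles: for a layer `1`-cocycle `γ` of `M^{U_E}` and
# `f : N₁ → J̄`, the idèle class `β = iso^J_E ((f^{U_E})_* δ γ) ∈ H²(Gal(E/K), J_E)` read out through ANY compatible pair
# `(s ↦ s|_E, π_v^E)` at ANY place `v` IS `(π_v ∘ f)_* res_v (δ₁^K x)` for the inflated class `x = [σ ↦ γ(σ̄)] ∈ H¹(K, M)`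
# — one lift, two connecting homomorphisms (Milne *ADT* I Thm. 4.10, proof; Serre *CG* I §2.2–2.3)

Topic `NumberTheory/GaloisRepresentations`; namespace `Literature.NumberTheory.GaloisRepresentations.FreePresentation`.
Definitions with bodies (the chosen lift, the connecting `2`-cochain, the inflated class, the transported idèle cocycle — all
explicit functions) and theorems; NO named fact, no instance, no notation, no `sorry`.  One LOCAL instance attribute
(`absoluteGaloisGroup_compactSpace`, the tree's theorem; continuous cocycle classes need `LocallyCompactSpace Γ`).

THE MATHEMATICS.  `S : 0 → N₁ → P → M → 0` is door-c4's canonical presentation of a finite discrete `Γ_K`-module `ρ`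
(`presentationComplex ρ`), `E ⊇ K(M)` a finite Galois layer, `U = U_E = Gal(K̄/E)`; `U` acts trivially on `P` and `N₁`, so
`S^U : 0 → N₁^U → P^U → M^U → 0` is short exact (`presentationComplex_map_invariantsQuotFunctor_shortExact`).  For a `1`-cocycle
`γ : Γ_K ⧸ U → M^U` choose the lift `y(q) := lift(γ q) ∈ P = P^U` through the chosen set-theoretic section `lift : M → P` of the
native presentation (`IsSES.lift`), and put `z(q₁, q₂) := f⁻¹(q₁·y(q₂) − y(q₁q₂) + y(q₁)) ∈ N₁ = N₁^U` (`IsSES.inv`).  THEN: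
* Mathlib's connecting homomorphism of `S^U` satisfies `δ[γ] = [z]` (`groupCohomology.δ₁_apply` — it accepts ANY lift);
* the native connecting homomorphism of the continuous presentation satisfies `δ₁^K [σ ↦ γ(σ̄)] = [(σ, τ) ↦ z(σ̄, τ̄)]`
  (`IsSES.δ₁_oneCocycleClass` with the continuous lift `σ ↦ y(σ̄)` — it, too, accepts ANY lift; the two `dOne` conventions
  `σ·φ(τ) − φ(στ) + φ(σ)` agree);
so NO comparison of the two `δ`'s is needed (this replaces the layer bridge + (N2) route).  Consequently, for `f : N₁ → J̄` in `C_Γ`,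
the class `β := iso^J_E ((f^U)_* δ[γ]) ∈ H²(Gal(E/K), J_E)` (door-c4 g17's E-side class, `IdeleClassBarBoundaryIdeleLayer`) is
represented by the cocycle `b₀(σ, τ) := layerEquiv (f (z(σ̃, τ̃)))` (`σ̃ = quotEquiv⁻¹ σ`), and for every place `v`, every idèle
projection `π : J̄ → K̄_vˣ` (door-c5 `HomDual.IdeleProjection`) and every compatible pair `P = (s ↦ s|_E, π^E)` from
`(Γ_{K_v}, K̄_vˣ)` to `(Gal(E/K), J_E)` whose components are `s|_E = (res s)|_E` and `π^E = π ∘ [·]_E`: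

  **`[pull_P b] = (π ∘ f)_* res_v (δ₁^K x)`  in `H²(Γ_{K_v}, K̄_vˣ)`, for EVERY cocycle `b` with `[b] = β`**

(`twoCocycleClass_pull_eq_of_H2π_eq`): both sides are the class of the SAME continuous cocycle `(s, t) ↦ π(f(z([res s], [res t])))`.
Door-c5's `readoutPair v (layerEmb E)` (finite `v`) and door-c4 g18's `archReadoutPair w (layerEmb E)` (infinite `w`) are such pairs
(`galRestrict(_)Field_layerEmb`, `ideleProjection_inr_of` / `_inl_of`), which gives items (P3) (with door-c5's `localInv_eq_readout`)
and (P4) of the E-side idèle package of `SchneiderFreeAdditiveX3PoitouTateReciprocityGeneralBase` — in the sequel file.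

HONEST FRAMING: bookkeeping with explicit cocycles; no arithmetic beyond the cited files; no case of Poitou–Tate or BSD is proved.
Route A (R4) transport of crux `AnticycControlAdditiveK` (item 19295, cell bsd-schneider), seat door-c4 gen 18 (the direct-cocycle
alternative to door-c6 g18's layer-bridge route (L1); different files and names).

## References
* J. S. Milne, *Arithmetic Duality Theorems* (2nd ed. 2006), I §4, proof of Theorem 4.10 (p. 58), Lemma 4.13. [MilneADT2006]
* J.-P. Serre, *Galois Cohomology* (1997), I §2.2 (inflation), §2.3 (connecting maps on cochains). [SerreGaloisCohomology1997]
* J. Neukirch, A. Schmidt, K. Wingberg, *Cohomology of Number Fields* (2008), (1.3.2), (1.5.1). [NeukirchSchmidtWingberg2008]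
-/

noncomputable section

open NumberField IsDedekindDomain CategoryTheory CategoryTheory.Abelian groupCohomology Function
open Field (absoluteGaloisGroup)
open Literature.Algebra.Homology Literature.Algebra.Homology.DiscreteRep
open Literature.NumberTheory.Automorphic
open scoped Classical

namespace Literature.NumberTheory.GaloisRepresentations

open IdeleClassBar DGMBridge HomDual DiscreteGaloisModule

namespace FreePresentation

-- continuous cocycle classes on `Γ_K`, `Γ_{K_v}` need `LocallyCompactSpace`; the tree's theorem, local, no override.
attribute [local instance] absoluteGaloisGroup_compactSpace

variable {K : Type} [Field K] [NumberField K]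
variable {M : Type} [AddCommGroup M] [TopologicalSpace M] [DiscreteTopology M] [Finite M] (ρ : DiscreteGaloisModule K M)

/-! ## §1 `U_E` acts trivially on `P` and on `N₁`; the chosen lift and the connecting `2`-cochain of a layer `1`-cocycle -/

section Lift

variable {E : GalLayer K} (h : presentationLayer ρ ≤ E)
include h

/-- `U_E` acts trivially on `P` (`E ⊇ K(M)`; `trivialOn_presLattice`). [cite: MilneADT2006, I Lemma 1.9 (proof)] -/
theorem presX₂_ρ_eq_of_mem {σ : absoluteGaloisGroup K}
    (hσ : σ ∈ (E.openNormalSubgroup : Subgroup (absoluteGaloisGroup K))) (p : (presentationComplex ρ).X₂.obj.V) :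
    (presentationComplex ρ).X₂.obj.ρ σ p = p :=
  (trivialOn_presLattice (presentationLayer ρ) (presentationRank ρ)).mono h σ hσ p

/-- `U_E` acts trivially on `N₁ ⊆ P`. [cite: MilneADT2006, I Lemma 1.9 (proof)] -/
theorem presX₁_ρ_eq_of_mem {σ : absoluteGaloisGroup K}
    (hσ : σ ∈ (E.openNormalSubgroup : Subgroup (absoluteGaloisGroup K))) (w : (presentationComplex ρ).X₁.obj.V) :
    (presentationComplex ρ).X₁.obj.ρ σ w = w := by
  apply presentationComplex_f_injective ρ
  rw [Rep.hom_comm_apply]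
  exact presX₂_ρ_eq_of_mem ρ h hσ _

/-- **The chosen lift `y(q) := lift(γ q) ∈ P^{U_E}`** of a layer `1`-cocycle `γ : Γ_K ⧸ U_E → M^{U_E}` through the chosen
set-theoretic section of `P → M`. [cite: SerreGaloisCohomology1997, I §2.3] -/
def liftFun (γ : cocycles₁ ((invariantsQuotFunctor ℤ (E.openNormalSubgroup : Subgroup (absoluteGaloisGroup K))).obj
      (presentationComplex ρ).X₃)) (q : absoluteGaloisGroup K ⧸ (E.openNormalSubgroup : Subgroup (absoluteGaloisGroup K))) :
    ((invariantsQuotFunctor ℤ (E.openNormalSubgroup : Subgroup (absoluteGaloisGroup K))).obj (presentationComplex ρ).X₂).V :=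
  ⟨LCarrier.val (presentationComplex ρ).X₂ ((pres_isSES ρ).lift (LCarrier.of (presentationComplex ρ).X₃ (γ q).1)),
    fun u => presX₂_ρ_eq_of_mem ρ h u.2 _⟩

/-- `g^{U}(y q) = γ q`. [cite: SerreGaloisCohomology1997, I §2.3] -/
theorem g_liftFun (γ : cocycles₁ ((invariantsQuotFunctor ℤ (E.openNormalSubgroup : Subgroup (absoluteGaloisGroup K))).obj
      (presentationComplex ρ).X₃)) :
    (((presentationComplex ρ).map
        (invariantsQuotFunctor ℤ (E.openNormalSubgroup : Subgroup (absoluteGaloisGroup K)))).g.hom : _ → _) ∘ liftFun ρ h γ =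
      (γ : _ → _) := by
  funext q
  apply Subtype.ext
  change (presentationComplex ρ).g.hom.hom
      (LCarrier.val (presentationComplex ρ).X₂ ((pres_isSES ρ).lift (LCarrier.of (presentationComplex ρ).X₃ (γ q).1))) = (γ q).1
  exact (pres_isSES ρ).g_lift _

/-- `g(q₁·y(q₂) − y(q₁q₂) + y(q₁)) = 0` (`γ` is a cocycle). [cite: SerreGaloisCohomology1997, I §2.3] -/
theorem g_d₁₂_liftFun_eq_zero (γ : cocycles₁ ((invariantsQuotFunctor ℤ (E.openNormalSubgroup : Subgroup (absoluteGaloisGroup K))).obj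
      (presentationComplex ρ).X₃))
    (q : (absoluteGaloisGroup K ⧸ (E.openNormalSubgroup : Subgroup (absoluteGaloisGroup K))) ×
      (absoluteGaloisGroup K ⧸ (E.openNormalSubgroup : Subgroup (absoluteGaloisGroup K)))) :
    ((presentationComplex ρ).map
        (invariantsQuotFunctor ℤ (E.openNormalSubgroup : Subgroup (absoluteGaloisGroup K)))).g.hom
      (d₁₂ _ (liftFun ρ h γ) q) = 0 := by
  have hγ := (mem_cocycles₁_iff γ).1 γ.2 q.1 q.2
  rw [d₁₂_hom_apply, map_add, map_sub, Rep.hom_comm_apply]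
  have hg : ∀ q', ((presentationComplex ρ).map
      (invariantsQuotFunctor ℤ (E.openNormalSubgroup : Subgroup (absoluteGaloisGroup K)))).g.hom (liftFun ρ h γ q') = γ q' :=
    fun q' => congrFun (g_liftFun ρ h γ) q'
  rw [hg, hg, hg, hγ]
  change ((invariantsQuotFunctor ℤ (E.openNormalSubgroup : Subgroup (absoluteGaloisGroup K))).obj
        (presentationComplex ρ).X₃).ρ q.1 (γ q.2) -
      (((invariantsQuotFunctor ℤ (E.openNormalSubgroup : Subgroup (absoluteGaloisGroup K))).obj
        (presentationComplex ρ).X₃).ρ q.1 (γ q.2) + γ q.1) + γ q.1 = 0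
  abel

/-- **The connecting `2`-cochain `z(q₁, q₂) := f⁻¹(q₁·y(q₂) − y(q₁q₂) + y(q₁)) ∈ N₁^{U_E}`** (`f⁻¹ = IsSES.inv` of the native
presentation). [cite: SerreGaloisCohomology1997, I §2.3] -/
def connFun (γ : cocycles₁ ((invariantsQuotFunctor ℤ (E.openNormalSubgroup : Subgroup (absoluteGaloisGroup K))).obj
      (presentationComplex ρ).X₃))
    (q : (absoluteGaloisGroup K ⧸ (E.openNormalSubgroup : Subgroup (absoluteGaloisGroup K))) ×
      (absoluteGaloisGroup K ⧸ (E.openNormalSubgroup : Subgroup (absoluteGaloisGroup K)))) :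
    ((invariantsQuotFunctor ℤ (E.openNormalSubgroup : Subgroup (absoluteGaloisGroup K))).obj (presentationComplex ρ).X₁).V :=
  ⟨LCarrier.val (presentationComplex ρ).X₁
      ((pres_isSES ρ).inv (LCarrier.of (presentationComplex ρ).X₂ (d₁₂ _ (liftFun ρ h γ) q).1)),
    fun u => presX₁_ρ_eq_of_mem ρ h u.2 _⟩

/-- `f^{U} ∘ z = d(y)`. [cite: SerreGaloisCohomology1997, I §2.3] -/
theorem f_connFun (γ : cocycles₁ ((invariantsQuotFunctor ℤ (E.openNormalSubgroup : Subgroup (absoluteGaloisGroup K))).obj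
      (presentationComplex ρ).X₃)) :
    (((presentationComplex ρ).map
        (invariantsQuotFunctor ℤ (E.openNormalSubgroup : Subgroup (absoluteGaloisGroup K)))).f.hom : _ → _) ∘ connFun ρ h γ =
      d₁₂ _ (liftFun ρ h γ) := by
  funext q
  apply Subtype.ext
  change (presentationComplex ρ).f.hom.hom (LCarrier.val (presentationComplex ρ).X₁
      ((pres_isSES ρ).inv (LCarrier.of (presentationComplex ρ).X₂ (d₁₂ _ (liftFun ρ h γ) q).1))) = (d₁₂ _ (liftFun ρ h γ) q).1
  refine (pres_isSES ρ).f_inv ?_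
  change (presentationComplex ρ).g.hom.hom ((d₁₂ _ (liftFun ρ h γ) q).1) = 0
  exact congrArg Subtype.val (g_d₁₂_liftFun_eq_zero ρ h γ q)

/-- The connecting `2`-cocycle `z` as an element of `Z²(Γ_K ⧸ U_E, N₁^{U_E})`. [cite: SerreGaloisCohomology1997, I §2.3] -/
def connCocycle (γ : cocycles₁ ((invariantsQuotFunctor ℤ (E.openNormalSubgroup : Subgroup (absoluteGaloisGroup K))).obj
      (presentationComplex ρ).X₃)) :
    cocycles₂ ((invariantsQuotFunctor ℤ (E.openNormalSubgroup : Subgroup (absoluteGaloisGroup K))).obj (presentationComplex ρ).X₁) :=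
  ⟨connFun ρ h γ, mem_cocycles₂_of_comp_eq_d₁₂ (presentationComplex_map_invariantsQuotFunctor_shortExact ρ h) (f_connFun ρ h γ)⟩

/-- **Mathlib's connecting homomorphism of `S^{U_E}` on `[γ]` is `[z]`** (`groupCohomology.δ₁_apply` with the chosen lift).
[cite: SerreGaloisCohomology1997, I §2.3][cite: MilneADT2006, I §4, proof of Theorem 4.10] -/
theorem δ_H1π_eq (γ : cocycles₁ ((invariantsQuotFunctor ℤ (E.openNormalSubgroup : Subgroup (absoluteGaloisGroup K))).obj
      (presentationComplex ρ).X₃)) :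
    (groupCohomology.δ (presentationComplex_map_invariantsQuotFunctor_shortExact ρ h) 1 2 rfl).hom ((H1π _) γ) =
      (H2π _) (connCocycle ρ h γ) :=
  δ₁_apply (presentationComplex_map_invariantsQuotFunctor_shortExact ρ h) γ (liftFun ρ h γ) (g_liftFun ρ h γ)
    (connFun ρ h γ) (f_connFun ρ h γ)

end Lift

/-! ## §2 The inflated class `x = [σ ↦ γ(σ̄)] ∈ H¹(K, M)` and its native connecting class `δ₁^K x = [(σ, τ) ↦ z(σ̄, τ̄)]` -/

section Native

variable {E : GalLayer K} (h : presentationLayer ρ ≤ E)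
include h

/-- The continuous lift `σ ↦ y(σ̄) ∈ P` (locally constant: it factors through `Γ_K ⧸ U_E`).
[cite: SerreGaloisCohomology1997, I §2.2, §2.3] -/
def liftCont (γ : cocycles₁ ((invariantsQuotFunctor ℤ (E.openNormalSubgroup : Subgroup (absoluteGaloisGroup K))).obj
      (presentationComplex ρ).X₃)) :
    C(absoluteGaloisGroup K, LCarrier (presentationComplex ρ).X₂) :=
  haveI : DiscreteTopology (absoluteGaloisGroup K ⧸ (E.openNormalSubgroup : Subgroup (absoluteGaloisGroup K))) :=
    QuotientGroup.discreteTopology E.openNormalSubgroup.isOpen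
  ⟨fun σ => LCarrier.of (presentationComplex ρ).X₂ (liftFun ρ h γ (QuotientGroup.mk σ)).1,
    (continuous_of_discreteTopology (f := fun q : absoluteGaloisGroup K ⧸
        (E.openNormalSubgroup : Subgroup (absoluteGaloisGroup K)) => LCarrier.of (presentationComplex ρ).X₂ (liftFun ρ h γ q).1)).comp
      continuous_quot_mk⟩

/-- Unfolding: `liftCont γ σ = y(σ̄)` in `P`. [cite: SerreGaloisCohomology1997, I §2.3] -/
theorem liftCont_apply (γ : cocycles₁ ((invariantsQuotFunctor ℤ (E.openNormalSubgroup : Subgroup (absoluteGaloisGroup K))).obj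
      (presentationComplex ρ).X₃)) (σ : absoluteGaloisGroup K) :
    liftCont ρ h γ σ = LCarrier.of (presentationComplex ρ).X₂ (liftFun ρ h γ (QuotientGroup.mk σ)).1 := rfl

/-- `presProj (liftCont γ σ) = γ(σ̄)` in `M`. [cite: SerreGaloisCohomology1997, I §2.3] -/
theorem presProj_liftCont (γ : cocycles₁ ((invariantsQuotFunctor ℤ (E.openNormalSubgroup : Subgroup (absoluteGaloisGroup K))).obj
      (presentationComplex ρ).X₃)) (σ : absoluteGaloisGroup K) :
    presProj ρ (liftCont ρ h γ σ) = (γ (QuotientGroup.mk σ)).1 :=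
  (pres_isSES ρ).g_lift _

/-- The lift `σ ↦ y(σ̄)` pushes to a crossed homomorphism into `M` (because `γ` is a `1`-cocycle of the layer).
[cite: SerreGaloisCohomology1997, I §2.3] -/
theorem liftCont_crossed (γ : cocycles₁ ((invariantsQuotFunctor ℤ (E.openNormalSubgroup : Subgroup (absoluteGaloisGroup K))).obj
      (presentationComplex ρ).X₃)) (σ τ : absoluteGaloisGroup K) :
    (toTopRepHom (presModule₂ ρ) ρ (presProj ρ)).hom (liftCont ρ h γ (σ * τ)) =
      (toTopRepHom (presModule₂ ρ) ρ (presProj ρ)).hom (liftCont ρ h γ σ) +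
        ρ σ ((toTopRepHom (presModule₂ ρ) ρ (presProj ρ)).hom (liftCont ρ h γ τ)) := by
  change presProj ρ (liftCont ρ h γ (σ * τ)) = presProj ρ (liftCont ρ h γ σ) + ρ σ (presProj ρ (liftCont ρ h γ τ))
  rw [presProj_liftCont, presProj_liftCont, presProj_liftCont]
  have hγ := (mem_cocycles₁_iff γ).1 γ.2 (QuotientGroup.mk σ) (QuotientGroup.mk τ)
  rw [← QuotientGroup.mk_mul] at hγ
  rw [hγ, add_comm]
  rfl

/-- **The inflated class `x := [σ ↦ γ(σ̄)] ∈ H¹(K, M)`** (the crossed homomorphism `presProj ∘ liftCont`, valued `γ(σ̄)`).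
[cite: SerreGaloisCohomology1997, I §2.2] -/
def inflatedClass (γ : cocycles₁ ((invariantsQuotFunctor ℤ (E.openNormalSubgroup : Subgroup (absoluteGaloisGroup K))).obj
      (presentationComplex ρ).X₃)) : galoisCohomology ρ 1 :=
  oneCocycleClass _ (IsSES.pushCocycle (liftCont ρ h γ) (liftCont_crossed ρ h γ))

/-- Unfolding: the cocycle of `inflatedClass γ` is `σ ↦ γ(σ̄)`. [cite: SerreGaloisCohomology1997, I §2.2] -/
theorem pushCocycle_liftCont_apply (γ : cocycles₁ ((invariantsQuotFunctor ℤ (E.openNormalSubgroup : Subgroup (absoluteGaloisGroup K))).obj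
      (presentationComplex ρ).X₃)) (σ : absoluteGaloisGroup K) :
    (IsSES.pushCocycle (liftCont ρ h γ) (liftCont_crossed ρ h γ) : contOneCocycles ρ.toTopRep).1 σ = (γ (QuotientGroup.mk σ)).1 :=
  presProj_liftCont ρ h γ σ

/-- **The native connecting homomorphism on the inflated class: `δ₁^K x = [(σ, τ) ↦ z(σ̄, τ̄)]`** — literally the same
cochain as Mathlib's `δ[γ]` (`δ_H1π_eq`), inflated; both connecting maps were computed with the same lift `y`.
[cite: SerreGaloisCohomology1997, I §2.2 Prop. 8, §2.3][cite: NeukirchSchmidtWingberg2008, (1.3.2), (1.5.1)] -/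
theorem δ₁_inflatedClass (γ : cocycles₁ ((invariantsQuotFunctor ℤ (E.openNormalSubgroup : Subgroup (absoluteGaloisGroup K))).obj
      (presentationComplex ρ).X₃)) :
    (pres_isSES ρ).δ₁ (inflatedClass ρ h γ) =
      twoCocycleClass _ ((pres_isSES ρ).connectingCocycle (liftCont ρ h γ) (liftCont_crossed ρ h γ)) :=
  (pres_isSES ρ).δ₁_oneCocycleClass _ _

/-- **The native connecting cocycle IS the inflated `z`**: `c(σ, τ) = z(σ̄, τ̄)` in `N₁` (both are `f⁻¹` of
`σ·y(τ̄) − y(σ̄τ̄) + y(σ̄)`). [cite: SerreGaloisCohomology1997, I §2.3] -/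
theorem connectingCocycle_liftCont_apply (γ : cocycles₁ ((invariantsQuotFunctor ℤ (E.openNormalSubgroup : Subgroup (absoluteGaloisGroup K))).obj
      (presentationComplex ρ).X₃)) (σ τ : absoluteGaloisGroup K) :
    ((pres_isSES ρ).connectingCocycle (liftCont ρ h γ) (liftCont_crossed ρ h γ)).1 (σ, τ) =
      LCarrier.of (presentationComplex ρ).X₁ (connFun ρ h γ (QuotientGroup.mk σ, QuotientGroup.mk τ)).1 := by
  apply (pres_isSES ρ).injective
  rw [(pres_isSES ρ).f_connectingCocycle_apply]
  have hzero : (toTopRepHom (presModule₂ ρ) ρ (presProj ρ)).hom (LCarrier.of (presentationComplex ρ).X₂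
      (d₁₂ _ (liftFun ρ h γ) (QuotientGroup.mk σ, QuotientGroup.mk τ)).1) = 0 :=
    congrArg Subtype.val (g_d₁₂_liftFun_eq_zero ρ h γ (QuotientGroup.mk σ, QuotientGroup.mk τ))
  have hf := (pres_isSES ρ).f_inv hzero
  refine Eq.trans ?_ hf.symm
  rfl

end Native

/-! ## §3 The transported idèle cocycle `b₀` and THE TRANSPORT IDENTITY at every place -/

section Transport

variable {E : GalLayer K} (h : presentationLayer ρ ≤ E)

/-- `layerEquiv : J̄^{U_E} ≃ J_E` as a morphism `Res_{quotEquiv⁻¹} (J̄^{U_E}) ⟶ J_E` of `Gal(E/K)`-modules (the morphism inside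
door-c5's `layerCohomologyIso`). [cite: SerreGaloisCohomology1997, I §2.2 Proposition 8] -/
def layerToObjHom (E : GalLayer K) :
    Rep.res (E.quotEquiv.symm : (E.1 ≃ₐ[K] E.1) →* _) ((ideleData K).layerRep E) ⟶ (ideleData K).obj E :=
  Rep.ofHom ⟨((ideleData K).layerEquiv E).toLinearMap, fun τ => by
    have := (ideleData K).layerEquiv_comm E (E.quotEquiv.symm τ)
    rw [MulEquiv.apply_symm_apply] at this
    exact this⟩

/-- **door-c5's layer cohomology isomorphism is `Hⁿ(quotEquiv⁻¹, layerEquiv)`.** [cite: SerreGaloisCohomology1997, I §2.2 Proposition 8] -/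
theorem layerCohomologyIso_hom_eq (E : GalLayer K) (n : ℕ) :
    ((ideleData K).layerCohomologyIso E n).hom =
      groupCohomology.map (E.quotEquiv.symm : (E.1 ≃ₐ[K] E.1) →* _) (layerToObjHom E) n := by
  rw [GalLayerData.layerCohomologyIso, groupCohomology.mapIso_hom]
  exact map_congr' rfl _ _ (fun _ => rfl) n

include h

/-- **The transported idèle `2`-cocycle `b₀(σ, τ) = layerEquiv (f (z(σ̃, τ̃)))` of `Gal(E/K)` in `J_E`** (`σ̃ = quotEquiv⁻¹ σ`).
[cite: MilneADT2006, I §4, proof of Theorem 4.10][cite: SerreGaloisCohomology1997, I §2.2] -/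
def transportCocycle (γ : cocycles₁ ((invariantsQuotFunctor ℤ (E.openNormalSubgroup : Subgroup (absoluteGaloisGroup K))).obj
      (presentationComplex ρ).X₃)) (f : (presentationComplex ρ).X₁ ⟶ ideleBarD K) :
    cocycles₂ ((ideleData K).obj E) :=
  mapCocycles₂ (E.quotEquiv.symm : (E.1 ≃ₐ[K] E.1) →* _) (layerToObjHom E)
    (mapCocycles₂ (MonoidHom.id _)
      ((invariantsQuotFunctor ℤ (E.openNormalSubgroup : Subgroup (absoluteGaloisGroup K))).map f) (connCocycle ρ h γ))

/-- **`[b₀] = iso^J_E ((f^{U_E})_* δ[γ])`** — the transported cocycle represents door-c4 g17's E-side idèle class `β`.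
[cite: MilneADT2006, I §4, proof of Theorem 4.10] -/
theorem H2π_transportCocycle (γ : cocycles₁ ((invariantsQuotFunctor ℤ (E.openNormalSubgroup : Subgroup (absoluteGaloisGroup K))).obj
      (presentationComplex ρ).X₃)) (f : (presentationComplex ρ).X₁ ⟶ ideleBarD K) :
    ((ideleData K).layerCohomologyIso E 2).hom ((groupCohomology.map (MonoidHom.id _)
        ((invariantsQuotFunctor ℤ (E.openNormalSubgroup : Subgroup (absoluteGaloisGroup K))).map f) 2).hom
        ((groupCohomology.δ (presentationComplex_map_invariantsQuotFunctor_shortExact ρ h) 1 2 rfl).hom ((H1π _) γ))) =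
      (H2π _) (transportCocycle ρ h γ f) := by
  rw [δ_H1π_eq]
  have e1 : (groupCohomology.map (MonoidHom.id _)
        ((invariantsQuotFunctor ℤ (E.openNormalSubgroup : Subgroup (absoluteGaloisGroup K))).map f) 2).hom
        ((H2π _) (connCocycle ρ h γ)) =
      (H2π _) (mapCocycles₂ (MonoidHom.id _)
        ((invariantsQuotFunctor ℤ (E.openNormalSubgroup : Subgroup (absoluteGaloisGroup K))).map f) (connCocycle ρ h γ)) :=
    H2π_comp_map_apply _ _ _
  refine (congrArg (fun w => ((ideleData K).layerCohomologyIso E 2).hom w) e1).trans ?_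
  rw [layerCohomologyIso_hom_eq]
  exact H2π_comp_map_apply _ _ _

/-- The idèle `b₀(σ, τ) ∈ J_E` inside `J̄`: `[b₀(σ, τ)]_E = f (z(σ̃, τ̃))`. [cite: SerreGaloisCohomology1997, I §2.2] -/
theorem of_transportCocycle_apply (γ : cocycles₁ ((invariantsQuotFunctor ℤ (E.openNormalSubgroup : Subgroup (absoluteGaloisGroup K))).obj
      (presentationComplex ρ).X₃)) (f : (presentationComplex ρ).X₁ ⟶ ideleBarD K) (σ τ : E.1 ≃ₐ[K] E.1) :
    (ideleData K).toSystem.of E (transportCocycle ρ h γ f (σ, τ)) =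
      f.hom.hom (connFun ρ h γ (E.quotEquiv.symm σ, E.quotEquiv.symm τ)).1 := by
  change (ideleData K).toSystem.of E ((ideleData K).layerEquiv E
    (((invariantsQuotFunctor ℤ (E.openNormalSubgroup : Subgroup (absoluteGaloisGroup K))).map f).hom
      (connCocycle ρ h γ (E.quotEquiv.symm σ, E.quotEquiv.symm τ)))) = _
  rw [GalLayerData.of_layerEquiv]
  rfl

/-- **THE TRANSPORT IDENTITY (cocycle form).**  For every place `v`, every idèle projection `π : J̄ → K̄_vˣ` and every
compatible pair `P : (Γ_{K_v}, K̄_vˣ) → (Gal(E/K), J_E)` with `P.f s = (res s)|_E` and `P.φ = π ∘ [·]_E`: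
`[pull_P b₀] = (π ∘ f)_* res_v (δ₁^K x)` in `H²(Γ_{K_v}, K̄_vˣ)`, `x = inflatedClass γ` — both sides are the class of the
continuous cocycle `(s, t) ↦ π (f (z([res s], [res t])))`. [cite: MilneADT2006, I §4, proof of Theorem 4.10 (p. 58)]
[cite: SerreGaloisCohomology1997, I §2.2–2.3] -/
theorem twoCocycleClass_pull_transportCocycle (v : Place K) (π : IdeleProjection K v)
    (P : CompatiblePair ((ideleData K).obj E) (units (Place.Completion v)).toTopRep)
    (hPf : ∀ s, P.f s = E.restrictHom (absGaloisRestrict K (Place.Completion v) s))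
    (hPφ : ∀ x : (ideleData K).V E, P.φ x = π.toAddMonoidHom ((ideleData K).toSystem.of E x))
    (γ : cocycles₁ ((invariantsQuotFunctor ℤ (E.openNormalSubgroup : Subgroup (absoluteGaloisGroup K))).obj
      (presentationComplex ρ).X₃)) (f : (presentationComplex ρ).X₁ ⟶ ideleBarD K) :
    twoCocycleClass (units (Place.Completion v)).toTopRep (P.pull (transportCocycle ρ h γ f)) =
      (haveI := moduleFinite_presModule₁ ρ
       cohomologyMap (toTopRepHom ((presModule₁ ρ).restrictField (Place.Completion v)) (units (Place.Completion v))
          (equivariantMap ((presModule₁ ρ).restrictField (Place.Completion v)) (units (Place.Completion v))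
            (readoutInvariant π (presentationComplex ρ).X₁ f))) 2
        (galoisCohomology.res (presModule₁ ρ) (Place.Completion v) 2 ((pres_isSES ρ).δ₁ (inflatedClass ρ h γ)))) := by
  haveI := moduleFinite_presModule₁ ρ
  rw [δ₁_inflatedClass]
  have eres : galoisCohomology.res (presModule₁ ρ) (Place.Completion v) 2
      (twoCocycleClass _ ((pres_isSES ρ).connectingCocycle (liftCont ρ h γ) (liftCont_crossed ρ h γ))) =
      twoCocycleClass (DiscreteGaloisModule.toTopRep ((presModule₁ ρ).restrictField (Place.Completion v)))
        (contTwoCocycles.pullback (absGaloisRestrict K (Place.Completion v)) (X := (presModule₁ ρ).toTopRep)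
          (Y := DiscreteGaloisModule.toTopRep ((presModule₁ ρ).restrictField (Place.Completion v)))
          (TopRep.ofHom ⟨ContinuousLinearMap.id ℤ _, fun _ => rfl⟩)
          ((pres_isSES ρ).connectingCocycle (liftCont ρ h γ) (liftCont_crossed ρ h γ))) :=
    map_twoCocycleClass (absGaloisRestrict K (Place.Completion v)) (X := (presModule₁ ρ).toTopRep)
      (Y := DiscreteGaloisModule.toTopRep ((presModule₁ ρ).restrictField (Place.Completion v)))
      (TopRep.ofHom ⟨ContinuousLinearMap.id ℤ _, fun _ => rfl⟩) _
  rw [eres, cohomologyMap_twoCocycleClass]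
  congr 1
  apply Subtype.ext
  apply ContinuousMap.ext
  rintro ⟨s, t⟩
  rw [CompatiblePair.pull_apply, hPφ, of_transportCocycle_apply, hPf, hPf, GalLayer.restrictHom_apply, GalLayer.restrictHom_apply,
    GalLayer.quotEquiv_symm_restrictNormal, GalLayer.quotEquiv_symm_restrictNormal, contTwoCocycles.pullback_apply,
    contTwoCocycles.pullback_apply, connectingCocycle_liftCont_apply]
  rfl

/-- **THE TRANSPORT IDENTITY for EVERY cocycle representative of `β`**: if `[b] = iso^J_E ((f^{U_E})_* δ[γ])` then
`[pull_P b] = (π ∘ f)_* res_v (δ₁^K x)` (`pull` respects coboundaries). [cite: MilneADT2006, I §4, proof of Theorem 4.10 (p. 58)]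
[cite: SerreLocalFields1979, Ch. VII §5] -/
theorem twoCocycleClass_pull_eq_of_H2π_eq (v : Place K) (π : IdeleProjection K v)
    (P : CompatiblePair ((ideleData K).obj E) (units (Place.Completion v)).toTopRep)
    (hPf : ∀ s, P.f s = E.restrictHom (absGaloisRestrict K (Place.Completion v) s))
    (hPφ : ∀ x : (ideleData K).V E, P.φ x = π.toAddMonoidHom ((ideleData K).toSystem.of E x))
    (γ : cocycles₁ ((invariantsQuotFunctor ℤ (E.openNormalSubgroup : Subgroup (absoluteGaloisGroup K))).obj
      (presentationComplex ρ).X₃)) (f : (presentationComplex ρ).X₁ ⟶ ideleBarD K)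
    (b : cocycles₂ ((ideleData K).obj E))
    (hb : (H2π _) b = ((ideleData K).layerCohomologyIso E 2).hom ((groupCohomology.map (MonoidHom.id _)
        ((invariantsQuotFunctor ℤ (E.openNormalSubgroup : Subgroup (absoluteGaloisGroup K))).map f) 2).hom
        ((groupCohomology.δ (presentationComplex_map_invariantsQuotFunctor_shortExact ρ h) 1 2 rfl).hom ((H1π _) γ)))) :
    twoCocycleClass (units (Place.Completion v)).toTopRep (P.pull b) =
      (haveI := moduleFinite_presModule₁ ρ
       cohomologyMap (toTopRepHom ((presModule₁ ρ).restrictField (Place.Completion v)) (units (Place.Completion v))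
          (equivariantMap ((presModule₁ ρ).restrictField (Place.Completion v)) (units (Place.Completion v))
            (readoutInvariant π (presentationComplex ρ).X₁ f))) 2
        (galoisCohomology.res (presModule₁ ρ) (Place.Completion v) 2 ((pres_isSES ρ).δ₁ (inflatedClass ρ h γ)))) := by
  rw [← twoCocycleClass_pull_transportCocycle ρ h v π P hPf hPφ γ f]
  rw [H2π_transportCocycle ρ h γ f] at hb
  -- `b - b₀` is a coboundary, and pulled-back coboundaries are continuous coboundaries
  have hcob := (H2π_eq_iff b (transportCocycle ρ h γ f)).1 hb
  have hzero := CompatiblePair.twoCocycleClass_pull_eq_zero_of_mem_coboundaries P (b - transportCocycle ρ h γ f) hcob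
  rw [CompatiblePair.pull_sub, twoCocycleClass_sub, sub_eq_zero] at hzero
  exact hzero

end Transport

end FreePresentation

end Literature.NumberTheory.GaloisRepresentations

end
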